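/-
Copyright (c) 2026 the pub-hodgecm-mathlib formalisation cell (harness21).  Prover seat hodgecm-mathlib-F0P3-p02 (g26), 2026-09-03.  E1 row 47c R-c «JACQUET FUNCTOR OF THE
SCHNEIDER–STUHLER RESOLUTION», FILE 2b «THE COINVARIANTS OF A BLOCK-PERMUTATION MODULE ARE ℤ-GRADED BY HEIGHT; THE TORUS SHIFTS THE GRADING» (E1 keeper ∕ dealer F0P3a-p03 (g29)
02:13:33Z; census row 47 §2 (A3); plan 02:20:35Z; over ★ FILE 1 `CoinvariantsBlockPermutation` p853299).
-/
import Mathlib.LinearAlgebra.FiniteDimensional.Lemmas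
import Mathlib.LinearAlgebra.Isomorphisms
import Literature.RepresentationTheory.CoinvariantsBlockPermutation
import HarnessLib

/-!
# The coinvariants of a block-permutation module: grading by height, the shift, the degree-zero piece

Topic `RepresentationTheory`; declarations in the `Representation` namespace (deliberate dot-style extension, lean/CONVENTIONS.md §2).  THEOREMS ONLY (no definition, no instance,
no notation, no named fact, no `sorry`); Mathlib + ★ `Literature.RepresentationTheory.CoinvariantsBlockPermutation` only.  Cell `pub/hodgecm-mathlib` (D-0151), crux H413 =
`stmt-HodgeConjecture-24833`, lane `--supports`; E1 BRICK LEDGER row 47c FILE 2b.  HONEST LABEL: count-neutral generic base layer; (R-SS) NOT chartered; E1 = PRINT until the keeper's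
charter test; HC_CM is proved only modulo the 2 remaining named inputs (hLiu418 = `stmt-HodgeConjecture-24832`, h413 = `stmt-HodgeConjecture-24833`) until rung 0 closes.

THE MATHEMATICS ([Brown1982, III §5–§6]; [BernsteinZelevinsky1976, §2.3]; [Casselman1995, §3.1–§3.2, §6.3]).  Setting of ★ FILE 1: `τ` a `k`-linear representation of a group `N` on
`M = ⊕_{b ∈ β} W_b` (internal direct sum `Blk`), `N` acting on the labels by `act` with `τ(n) W_b ⊆ W_{n·b}`; orbit data `rep`, `tr` (`tr b · rep b = b`), representatives `R`; the
LOCAL KERNEL `K_r = span{τ(s) w − w : s·r = r, w ∈ W_r}`.  ★ FILE 1 proved `M_N = Σ_{r ∈ R} [W_r]` with `[Σ_r w_r] = 0 ↔ ∀ r, w_r ∈ K_r`.  Here: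
* (§1) the image `[W_b]` of a block in `M_N` depends only on the orbit: `[W_b] = [W_{rep b}]`;
* (§2) membership in `Σ_{r ∈ S} [W_r]` (finitely supported families of block vectors);
* (§3) for DISJOINT `S₁, S₂ ⊆ R` the pieces `Σ_{r ∈ S₁} [W_r]` and `Σ_{r ∈ S₂} [W_r]` are DISJOINT; hence for a HEIGHT `ht : β → ℤ` the pieces `M_N⁽ⁿ⁾ := Σ_{r ∈ R, ht r = n} [W_r]`
  form an INTERNAL DIRECT SUM `M_N = ⊕_{n ∈ ℤ} M_N⁽ⁿ⁾` (`isInternal_heightPiece`);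
* (§4) a linear `T` on `M` permuting the blocks, `T(W_b) = W_{sh b}`, and descending to `T̄` on `M_N` (`T̄[m] = [T m]` — e.g. a torus element normalising `N`), with `sh` raising the
  height of representatives by one and hitting every representative, SHIFTS the grading: `T̄(M_N⁽ⁿ⁾) = M_N⁽ⁿ⁺¹⁾` (`map_heightPiece_eq`);
* (§5) the degree-`0` piece has dimension `Σ_{r ∈ R, ht r = 0} dim (W_r ⧸ K_r)` (`finrank_heightPiece_zero_eq_sum`; `[W_r] ≅ W_r ⧸ K_r` by ★ FILE 1 §3).
With ★ 47c FILE 2a (`LinearMap.injective_sub_id_of_shift`, `finrank_quotient_range_sub_id_eq`) this gives: `T̄ − 1` is injective on `M_N` and `dim M_N ⧸ (T̄ − 1) M_N = Σ_{r ∈ R, ht r = 0}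
dim W_r ⧸ K_r`.  Model: `M = C_q(X) = ⊕_{F ∈ X_q} V^{U_F}` a chain module of the Schneider–Stuhler resolution on the Bruhat–Tits tree, `N` the unipotent radical of a minimal parabolic
`B = T N`, the `N`-orbits in a `B`-orbit of facets forming a `τ`-string `N τ^n F` (`ht = n`), `T = ρ(τ)`, `T̄ = r_B(τ)` on the Jacquet module `(C_q)_N`, `W_F ⧸ K_F = (V^{U_F})_{N ∩ P_F}`.
Everything is hypothesis-style (the letters `R, rep, tr, ht, sh` are supplied by the consumer); no finiteness of `β`, of the orbits or of `N` is assumed except in §5 (blocks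
finite-dimensional, finitely many representatives of height `0`).

## References
* [Brown1982] K. S. Brown, *Cohomology of Groups* (1982): III §5–§6 (induced modules, Shapiro's lemma, `H₀` of an induced module).
* [BernsteinZelevinsky1976] I. N. Bernstein, A. V. Zelevinsky, *Representations of the group GL(n, F)…*, Russian Math. Surveys 31 (1976): §2.3 (the Jacquet functor `V ↦ V_N`).
* [Casselman1995] W. Casselman, *Introduction to the theory of admissible representations of p-adic reductive groups*: §3.1–§3.2, §6.3 (Jacquet modules of induced representations;
  the geometric lemma).
-/

set_option autoImplicit false

open scoped BigOperators DirectSum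

namespace Representation

variable {k N M : Type*} [Field k] [Group N] [AddCommGroup M] [Module k M] {τ : Representation k N M}
variable {β : Type*} {Blk : β → Submodule k M} {act : N → β → β}

/-! ## §1 The image of a block in the coinvariants depends only on the orbit -/

/-- `[W_b] ⊆ [W_{n·b}]` in `M_N`: `[w] = [τ(n) w]`. [cite: Brown1982, III §5] -/
theorem map_mk_block_le_map_mk_block_act (hperm : ∀ n b m, m ∈ Blk b → τ n m ∈ Blk (act n b)) (n : N) (b : β) :
    (Blk b).map (Coinvariants.mk τ) ≤ (Blk (act n b)).map (Coinvariants.mk τ) := by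
  rintro _ ⟨w, hw, rfl⟩
  exact ⟨τ n w, hperm n b w hw, Coinvariants.mk_self_apply τ n w⟩

/-- **`[W_b] = [W_{rep b}]`** in `M_N` (transport along `tr b`). [cite: Brown1982, III §5] -/
theorem map_mk_block_eq_map_mk_block_rep (hact : ∀ n n' b, act (n * n') b = act n (act n' b)) (hact1 : ∀ b, act 1 b = b)
    (hperm : ∀ n b m, m ∈ Blk b → τ n m ∈ Blk (act n b)) (rep : β → β) (tr : β → N) (htr : ∀ b, act (tr b) (rep b) = b) (b : β) :
    (Blk b).map (Coinvariants.mk τ) = (Blk (rep b)).map (Coinvariants.mk τ) := by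
  refine le_antisymm ?_ ?_
  · rintro _ ⟨w, hw, rfl⟩
    exact ⟨τ (tr b)⁻¹ w, apply_inv_mem_block hact hact1 hperm (by rw [htr]; exact hw), (coinvariants_mk_eq_mk_apply_inv (tr b) w).symm⟩
  · have := map_mk_block_le_map_mk_block_act (τ := τ) hperm (tr b) (rep b)
    rwa [htr] at this

/-! ## §2 Membership in a partial sum of block images -/

/-- **MEMBERSHIP IN `Σ_{r ∈ S} [W_r]`**: `x` lies in `⨆_{r ∈ S} [W_r]` iff `x = [Σ_b f b]` for a finitely supported family of block vectors `f b ∈ W_b` supported in `S`.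
[cite: Brown1982, III §5] -/
theorem mem_biSup_map_mk_iff (S : Set β) (x : Coinvariants τ) :
    x ∈ (⨆ r ∈ S, (Blk r).map (Coinvariants.mk τ)) ↔
      ∃ f : β →₀ M, (∀ b ∈ f.support, b ∈ S) ∧ (∀ b, f b ∈ Blk b) ∧ Coinvariants.mk τ (f.sum fun _ m => m) = x := by
  classical
  constructor
  · intro hx
    let P : Submodule k (Coinvariants τ) :=
      { carrier := {x | ∃ f : β →₀ M, (∀ b ∈ f.support, b ∈ S) ∧ (∀ b, f b ∈ Blk b) ∧ Coinvariants.mk τ (f.sum fun _ m => m) = x}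
        zero_mem' := ⟨0, fun b hb => absurd hb (by simp), fun b => by simp, by simp⟩
        add_mem' := by
          rintro _ _ ⟨f, hfS, hfB, rfl⟩ ⟨g, hgS, hgB, rfl⟩
          refine ⟨f + g, fun b hb => ?_, fun b => ?_, ?_⟩
          · rcases Finset.mem_union.1 (Finsupp.support_add hb) with h | h
            · exact hfS b h
            · exact hgS b h
          · rw [Finsupp.add_apply]; exact Submodule.add_mem _ (hfB b) (hgB b)
          · rw [Finsupp.sum_add_index' (fun _ => rfl) (fun _ _ _ => rfl), map_add]
        smul_mem' := by
          rintro c _ ⟨f, hfS, hfB, rfl⟩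
          refine ⟨c • f, fun b hb => hfS b (Finsupp.support_smul hb), fun b => ?_, ?_⟩
          · rw [Finsupp.smul_apply]; exact Submodule.smul_mem _ _ (hfB b)
          · rw [Finsupp.sum_smul_index' (fun _ => rfl), show (f.sum fun _ m => c • m) = c • (f.sum fun _ m => m) from Finsupp.smul_sum.symm,
              map_smul] }
    have hle : (⨆ r ∈ S, (Blk r).map (Coinvariants.mk τ)) ≤ P := by
      refine iSup₂_le fun r hr => ?_
      rintro _ ⟨w, hw, rfl⟩
      refine ⟨Finsupp.single r w, fun b hb => ?_, fun b => ?_, ?_⟩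
      · have := Finsupp.support_single_subset hb
        rw [Finset.mem_singleton] at this
        rw [this]; exact hr
      · by_cases hbr : b = r
        · subst hbr; rw [Finsupp.single_eq_same]; exact hw
        · rw [Finsupp.single_eq_of_ne hbr]; exact Submodule.zero_mem _
      · rw [Finsupp.sum_single_index rfl]
    exact hle hx
  · rintro ⟨f, hfS, hfB, rfl⟩
    rw [map_finsuppSum]
    refine Submodule.finsuppSum_mem k _ f _ fun b hb => ?_
    exact Submodule.mem_iSup_of_mem b (Submodule.mem_iSup_of_mem (hfS b (Finsupp.mem_support_iff.2 hb)) ⟨f b, hfB b, rfl⟩)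

/-! ## §3 Disjoint sets of representatives give disjoint pieces; the grading by height -/

/-- **DISJOINT REPRESENTATIVE SETS GIVE DISJOINT PIECES**: for `S₁, S₂ ⊆ R` disjoint, `(Σ_{r ∈ S₁} [W_r]) ∩ (Σ_{r ∈ S₂} [W_r]) = 0` in `M_N` — the blockwise criterion `[Σ_r w_r] = 0 ↔
∀ r, w_r ∈ K_r` of ★ FILE 1. [cite: Brown1982, III §5–§6] [cite: BernsteinZelevinsky1976, §2.3] -/
theorem disjoint_biSup_map_mk [DecidableEq β] (h : DirectSum.IsInternal Blk) (hact : ∀ n n' b, act (n * n') b = act n (act n' b)) (hact1 : ∀ b, act 1 b = b)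
    (hperm : ∀ n b m, m ∈ Blk b → τ n m ∈ Blk (act n b)) {R : Set β} (rep : β → β) (tr : β → N) (htr : ∀ b, act (tr b) (rep b) = b)
    (hrep_act : ∀ n b, rep (act n b) = rep b) (hrep_id : ∀ r ∈ R, rep r = r) {S₁ S₂ : Set β} (hS₁ : S₁ ⊆ R) (hS₂ : S₂ ⊆ R) (hdisj : Disjoint S₁ S₂) :
    Disjoint (⨆ r ∈ S₁, (Blk r).map (Coinvariants.mk τ)) (⨆ r ∈ S₂, (Blk r).map (Coinvariants.mk τ)) := by
  classical
  rw [Submodule.disjoint_def]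
  intro x hx₁ hx₂
  obtain ⟨f, hfS, hfB, rfl⟩ := (mem_biSup_map_mk_iff S₁ _).1 hx₁
  obtain ⟨g, hgS, hgB, hfg⟩ := (mem_biSup_map_mk_iff S₂ _).1 hx₂
  -- `[Σ (f - g)] = 0`
  have hzero : Coinvariants.mk τ ((f - g).sum fun _ m => m) = 0 := by
    rw [Finsupp.sum_sub_index (fun _ _ _ => rfl), map_sub, hfg, sub_self]
  have hsupp : (f - g).support ⊆ f.support ∪ g.support := by
    rw [sub_eq_add_neg]
    refine Finsupp.support_add.trans ?_
    rw [Finsupp.support_neg]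
  have hR' : ∀ b ∈ (f - g).support, b ∈ R := fun b hb => by
    rcases Finset.mem_union.1 (hsupp hb) with h' | h'
    · exact hS₁ (hfS b h')
    · exact hS₂ (hgS b h')
  have hB' : ∀ b, (f - g) b ∈ Blk b := fun b => by
    rw [Finsupp.sub_apply]; exact Submodule.sub_mem _ (hfB b) (hgB b)
  have hK := (coinvariants_mk_finsupp_sum_eq_zero_iff h hact hact1 hperm rep tr htr hrep_act hrep_id (f - g) hR' hB').1 hzero
  -- every `f r` with `r ∈ supp f ⊆ S₁` equals `(f - g) r ∈ K_r`, so its class vanishes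
  rw [map_finsuppSum, Finsupp.sum]
  refine Finset.sum_eq_zero fun r hr => ?_
  have hgr : g r = 0 := Finsupp.notMem_support_iff.1 fun hr' => Set.disjoint_left.1 hdisj (hfS r hr) (hgS r hr')
  have hfr : f r = (f - g) r := by rw [Finsupp.sub_apply, hgr, sub_zero]
  have := hK r
  rw [← hfr] at this
  exact coinvariants_mk_eq_zero_of_mem_localKer r this

/-- **THE HEIGHT PIECES SPAN**: `M_N = Σ_n M_N⁽ⁿ⁾`, `M_N⁽ⁿ⁾ = Σ_{r ∈ R, ht r = n} [W_r]` (every class comes from the representatives, ★ FILE 1 §2). [cite: Brown1982, III §5–§6] -/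
theorem iSup_heightPiece_eq_top [DecidableEq β] (h : DirectSum.IsInternal Blk) (hact : ∀ n n' b, act (n * n') b = act n (act n' b)) (hact1 : ∀ b, act 1 b = b)
    (hperm : ∀ n b m, m ∈ Blk b → τ n m ∈ Blk (act n b)) {R : Set β} (rep : β → β) (tr : β → N) (hrepR : ∀ b, rep b ∈ R)
    (htr : ∀ b, act (tr b) (rep b) = b) (ht : β → ℤ) {W : ℤ → Submodule k (Coinvariants τ)}
    (hW : ∀ n, W n = ⨆ r ∈ {r | r ∈ R ∧ ht r = n}, (Blk r).map (Coinvariants.mk τ)) : iSup W = ⊤ := by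
  classical
  rw [Submodule.eq_top_iff']
  intro x
  obtain ⟨f, hfR, hfB, rfl⟩ := exists_finsupp_blocks_mk_sum_eq h hact hact1 hperm rep tr hrepR htr x
  rw [map_finsuppSum]
  refine Submodule.finsuppSum_mem k _ f _ fun b hb => ?_
  refine Submodule.mem_iSup_of_mem (ht b) ?_
  rw [hW]
  exact Submodule.mem_iSup_of_mem b (Submodule.mem_iSup_of_mem (show b ∈ {r | r ∈ R ∧ ht r = ht b} from ⟨hfR b (Finsupp.mem_support_iff.2 hb), rfl⟩) ⟨f b, hfB b, rfl⟩)

/-- **THE HEIGHT PIECES ARE INDEPENDENT**: `M_N⁽ⁿ⁾ ∩ Σ_{m ≠ n} M_N⁽ᵐ⁾ = 0`. [cite: Brown1982, III §5–§6] [cite: BernsteinZelevinsky1976, §2.3] -/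
theorem iSupIndep_heightPiece [DecidableEq β] (h : DirectSum.IsInternal Blk) (hact : ∀ n n' b, act (n * n') b = act n (act n' b)) (hact1 : ∀ b, act 1 b = b)
    (hperm : ∀ n b m, m ∈ Blk b → τ n m ∈ Blk (act n b)) {R : Set β} (rep : β → β) (tr : β → N) (htr : ∀ b, act (tr b) (rep b) = b)
    (hrep_act : ∀ n b, rep (act n b) = rep b) (hrep_id : ∀ r ∈ R, rep r = r) (ht : β → ℤ) {W : ℤ → Submodule k (Coinvariants τ)}
    (hW : ∀ n, W n = ⨆ r ∈ {r | r ∈ R ∧ ht r = n}, (Blk r).map (Coinvariants.mk τ)) : iSupIndep W := by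
  classical
  rw [iSupIndep_def]
  intro n
  have hle : (⨆ (m : ℤ) (_ : m ≠ n), W m) ≤ ⨆ r ∈ {r | r ∈ R ∧ ht r ≠ n}, (Blk r).map (Coinvariants.mk τ) := by
    refine iSup₂_le fun m hm => ?_
    rw [hW]
    refine iSup₂_le fun r hr => ?_
    exact le_biSup (fun r => (Blk r).map (Coinvariants.mk τ)) (show r ∈ {r | r ∈ R ∧ ht r ≠ n} from ⟨hr.1, by rw [hr.2]; exact hm⟩)
  rw [hW]
  refine (disjoint_biSup_map_mk h hact hact1 hperm rep tr htr hrep_act hrep_id (S₁ := {r | r ∈ R ∧ ht r = n}) (S₂ := {r | r ∈ R ∧ ht r ≠ n})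
    (fun r hr => hr.1) (fun r hr => hr.1) ?_).mono_right hle
  exact Set.disjoint_left.2 fun r hr₁ hr₂ => hr₂.2 hr₁.2

/-- **`M_N = ⊕_{n ∈ ℤ} M_N⁽ⁿ⁾` IS AN INTERNAL DIRECT SUM** (the grading of the coinvariants by the height of the representatives). [cite: Brown1982, III §5–§6] [cite: Casselman1995, §6.3] -/
theorem isInternal_heightPiece [DecidableEq β] (h : DirectSum.IsInternal Blk) (hact : ∀ n n' b, act (n * n') b = act n (act n' b)) (hact1 : ∀ b, act 1 b = b)
    (hperm : ∀ n b m, m ∈ Blk b → τ n m ∈ Blk (act n b)) {R : Set β} (rep : β → β) (tr : β → N) (hrepR : ∀ b, rep b ∈ R)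
    (htr : ∀ b, act (tr b) (rep b) = b) (hrep_act : ∀ n b, rep (act n b) = rep b) (hrep_id : ∀ r ∈ R, rep r = r) (ht : β → ℤ)
    {W : ℤ → Submodule k (Coinvariants τ)} (hW : ∀ n, W n = ⨆ r ∈ {r | r ∈ R ∧ ht r = n}, (Blk r).map (Coinvariants.mk τ)) :
    DirectSum.IsInternal W :=
  (DirectSum.isInternal_submodule_iff_iSupIndep_and_iSup_eq_top W).2
    ⟨iSupIndep_heightPiece h hact hact1 hperm rep tr htr hrep_act hrep_id ht hW, iSup_heightPiece_eq_top h hact hact1 hperm rep tr hrepR htr ht hW⟩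

/-! ## §4 The shift -/

/-- **THE TORUS SHIFTS THE GRADING**: if `T(W_b) = W_{sh b}`, `T̄ [m] = [T m]` on `M_N`, `sh` raises the height of representatives by one (`ht (rep (sh r)) = ht r + 1`, `r ∈ R`) and
every representative is `rep (sh r)` for some `r ∈ R`, then `T̄ (M_N⁽ⁿ⁾) = M_N⁽ⁿ⁺¹⁾`. [cite: Casselman1995, §6.3] [cite: BernsteinZelevinsky1976, §2.3] -/
theorem map_heightPiece_eq (hact : ∀ n n' b, act (n * n') b = act n (act n' b)) (hact1 : ∀ b, act 1 b = b)
    (hperm : ∀ n b m, m ∈ Blk b → τ n m ∈ Blk (act n b)) {R : Set β} (rep : β → β) (tr : β → N) (hrepR : ∀ b, rep b ∈ R)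
    (htr : ∀ b, act (tr b) (rep b) = b) (ht : β → ℤ) {T : M →ₗ[k] M} {Tbar : Coinvariants τ →ₗ[k] Coinvariants τ}
    (hTbar : ∀ m, Tbar (Coinvariants.mk τ m) = Coinvariants.mk τ (T m)) {sh : β → β} (hT : ∀ b, (Blk b).map T = Blk (sh b))
    (hsh : ∀ r ∈ R, ht (rep (sh r)) = ht r + 1) (hsh' : ∀ r' ∈ R, ∃ r ∈ R, rep (sh r) = r') {W : ℤ → Submodule k (Coinvariants τ)}
    (hW : ∀ n, W n = ⨆ r ∈ {r | r ∈ R ∧ ht r = n}, (Blk r).map (Coinvariants.mk τ)) (n : ℤ) : (W n).map Tbar = W (n + 1) := by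
  have hcomp : Tbar ∘ₗ Coinvariants.mk τ = Coinvariants.mk τ ∘ₗ T := LinearMap.ext hTbar
  have hblock : ∀ b, ((Blk b).map (Coinvariants.mk τ)).map Tbar = (Blk (rep (sh b))).map (Coinvariants.mk τ) := fun b => by
    rw [← Submodule.map_comp, hcomp, Submodule.map_comp, hT, map_mk_block_eq_map_mk_block_rep hact hact1 hperm rep tr htr]
  rw [hW, hW]
  simp_rw [Submodule.map_iSup, hblock]
  refine le_antisymm (iSup₂_le fun r hr => ?_) (iSup₂_le fun r' hr' => ?_)
  · exact le_biSup (fun r => (Blk r).map (Coinvariants.mk τ)) (show rep (sh r) ∈ {r | r ∈ R ∧ ht r = n + 1} from ⟨hrepR _, by rw [hsh r hr.1, hr.2]⟩)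
  · obtain ⟨r, hrR, hr⟩ := hsh' r' hr'.1
    have hn : ht r = n := by have := hsh r hrR; rw [hr, hr'.2] at this; omega
    rw [← hr]
    exact le_biSup (fun r => (Blk (rep (sh r))).map (Coinvariants.mk τ)) (show r ∈ {r | r ∈ R ∧ ht r = n} from ⟨hrR, hn⟩)

/-! ## §5 The degree-zero piece: `dim M_N⁽⁰⁾ = Σ_{r ∈ R, ht r = 0} dim W_r ⧸ K_r` -/

/-- The kernel of `W_r → M_N` (`r ∈ R`) is the local kernel `K_r` (★ FILE 1 §3), as a submodule of `W_r`. [cite: Brown1982, III §6 (6.2)] -/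
theorem ker_mk_comp_subtype_block_eq [DecidableEq β] (h : DirectSum.IsInternal Blk) (hact : ∀ n n' b, act (n * n') b = act n (act n' b)) (hact1 : ∀ b, act 1 b = b)
    (hperm : ∀ n b m, m ∈ Blk b → τ n m ∈ Blk (act n b)) {R : Set β} (rep : β → β) (tr : β → N) (htr : ∀ b, act (tr b) (rep b) = b)
    (hrep_act : ∀ n b, rep (act n b) = rep b) (hrep_id : ∀ r ∈ R, rep r = r) {r : β} (hr : r ∈ R) :
    LinearMap.ker (Coinvariants.mk τ ∘ₗ (Blk r).subtype) =
      (Submodule.span k {x : M | ∃ (s : N) (w : M), act s r = r ∧ w ∈ Blk r ∧ x = τ s w - w}).comap (Blk r).subtype := by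
  ext w
  rw [LinearMap.mem_ker, Submodule.mem_comap, LinearMap.comp_apply, Submodule.subtype_apply]
  exact coinvariants_mk_eq_zero_iff_mem_localKer h hact hact1 hperm rep tr htr hrep_act hrep_id hr w.2

/-- **`dim [W_r] = dim W_r ⧸ K_r`** for a representative `r` (first isomorphism theorem for `W_r → M_N`). [cite: Brown1982, III §6 (6.2)] -/
theorem finrank_map_mk_block_eq [DecidableEq β] (h : DirectSum.IsInternal Blk) (hact : ∀ n n' b, act (n * n') b = act n (act n' b)) (hact1 : ∀ b, act 1 b = b)
    (hperm : ∀ n b m, m ∈ Blk b → τ n m ∈ Blk (act n b)) {R : Set β} (rep : β → β) (tr : β → N) (htr : ∀ b, act (tr b) (rep b) = b)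
    (hrep_act : ∀ n b, rep (act n b) = rep b) (hrep_id : ∀ r ∈ R, rep r = r) {r : β} (hr : r ∈ R) :
    Module.finrank k ((Blk r).map (Coinvariants.mk τ)) =
      Module.finrank k (↥(Blk r) ⧸ (Submodule.span k {x : M | ∃ (s : N) (w : M), act s r = r ∧ w ∈ Blk r ∧ x = τ s w - w}).comap (Blk r).subtype) := by
  have hrange : LinearMap.range (Coinvariants.mk τ ∘ₗ (Blk r).subtype) = (Blk r).map (Coinvariants.mk τ) := by
    rw [LinearMap.range_comp, Submodule.range_subtype]
  have e := ((Submodule.quotEquivOfEq _ _ (ker_mk_comp_subtype_block_eq h hact hact1 hperm rep tr htr hrep_act hrep_id hr)).symm.trans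
    ((Coinvariants.mk τ ∘ₗ (Blk r).subtype).quotKerEquivRange)).trans (LinearEquiv.ofEq _ _ hrange)
  exact e.finrank_eq.symm

/-- **`dim Σ_{r ∈ R₀} [W_r] = Σ_{r ∈ R₀} dim W_r ⧸ K_r`** for a finite set `R₀` of representatives and finite-dimensional blocks (the pieces are independent, §3).
[cite: Brown1982, III §5–§6] -/
theorem finrank_biSup_map_mk_eq_sum [DecidableEq β] (h : DirectSum.IsInternal Blk) (hact : ∀ n n' b, act (n * n') b = act n (act n' b)) (hact1 : ∀ b, act 1 b = b)
    (hperm : ∀ n b m, m ∈ Blk b → τ n m ∈ Blk (act n b)) {R : Set β} (rep : β → β) (tr : β → N) (htr : ∀ b, act (tr b) (rep b) = b)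
    (hrep_act : ∀ n b, rep (act n b) = rep b) (hrep_id : ∀ r ∈ R, rep r = r) (hfd : ∀ b, FiniteDimensional k (Blk b)) (R₀ : Finset β)
    (hR₀ : ∀ r ∈ R₀, r ∈ R) :
    Module.finrank k ↥(⨆ r ∈ R₀, (Blk r).map (Coinvariants.mk τ)) =
      ∑ r ∈ R₀, Module.finrank k (↥(Blk r) ⧸ (Submodule.span k {x : M | ∃ (s : N) (w : M), act s r = r ∧ w ∈ Blk r ∧ x = τ s w - w}).comap (Blk r).subtype) := by
  classical
  haveI : ∀ b, FiniteDimensional k (Blk b) := hfd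
  induction R₀ using Finset.induction_on with
  | empty => rw [← Finset.iSup_coe, Finset.coe_empty, iSup_emptyset, finrank_bot, Finset.sum_empty]
  | insert a s ha ih =>
    have hRs : ∀ r ∈ s, r ∈ R := fun r hr => hR₀ r (Finset.mem_insert_of_mem hr)
    have haR : a ∈ R := hR₀ a (Finset.mem_insert_self a s)
    rw [Finset.sum_insert ha, ← ih hRs, Finset.iSup_insert, ← finrank_map_mk_block_eq h hact hact1 hperm rep tr htr hrep_act hrep_id haR]
    -- the new block image is disjoint from the previous pieces
    have hdisj : Disjoint ((Blk a).map (Coinvariants.mk τ)) (⨆ r ∈ s, (Blk r).map (Coinvariants.mk τ)) := by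
      have hd := disjoint_biSup_map_mk h hact hact1 hperm rep tr htr hrep_act hrep_id (S₁ := ({a} : Set β)) (S₂ := (s : Set β))
        (by rintro r hr; rw [Set.mem_singleton_iff] at hr; rw [hr]; exact haR) (fun r hr => hRs r (Finset.mem_coe.1 hr))
        (Set.disjoint_singleton_left.2 (fun h' => ha (Finset.mem_coe.1 h')))
      refine (hd.mono_left (le_biSup (fun r => (Blk r).map (Coinvariants.mk τ)) (Set.mem_singleton a))).mono_right ?_
      exact iSup₂_le fun r hr => le_biSup (fun r => (Blk r).map (Coinvariants.mk τ)) (Finset.mem_coe.2 hr)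
    haveI : FiniteDimensional k ↥(⨆ r ∈ s, (Blk r).map (Coinvariants.mk τ)) := by
      rw [← Finset.sup_eq_iSup]; infer_instance
    have hdim := Submodule.finrank_sup_add_finrank_inf_eq ((Blk a).map (Coinvariants.mk τ)) (⨆ r ∈ s, (Blk r).map (Coinvariants.mk τ))
    rw [hdisj.eq_bot, finrank_bot, add_zero] at hdim
    exact hdim

/-- **THE DEGREE-ZERO PIECE: `dim M_N⁽⁰⁾ = Σ_{r ∈ R, ht r = 0} dim W_r ⧸ K_r`** (finitely many representatives of height `0`, listed by `R₀`; finite-dimensional blocks).  With ★ 47c FILE 2a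
this is the dimension of the cokernel of `T̄ − 1` on `M_N`. [cite: Brown1982, III §5–§6] [cite: Casselman1995, §6.3] -/
theorem finrank_heightPiece_zero_eq_sum [DecidableEq β] (h : DirectSum.IsInternal Blk) (hact : ∀ n n' b, act (n * n') b = act n (act n' b)) (hact1 : ∀ b, act 1 b = b)
    (hperm : ∀ n b m, m ∈ Blk b → τ n m ∈ Blk (act n b)) {R : Set β} (rep : β → β) (tr : β → N) (htr : ∀ b, act (tr b) (rep b) = b)
    (hrep_act : ∀ n b, rep (act n b) = rep b) (hrep_id : ∀ r ∈ R, rep r = r) (hfd : ∀ b, FiniteDimensional k (Blk b)) (ht : β → ℤ)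
    {W : ℤ → Submodule k (Coinvariants τ)} (hW : ∀ n, W n = ⨆ r ∈ {r | r ∈ R ∧ ht r = n}, (Blk r).map (Coinvariants.mk τ))
    (R₀ : Finset β) (hR₀ : ∀ r, r ∈ R₀ ↔ r ∈ R ∧ ht r = 0) :
    Module.finrank k (W 0) =
      ∑ r ∈ R₀, Module.finrank k (↥(Blk r) ⧸ (Submodule.span k {x : M | ∃ (s : N) (w : M), act s r = r ∧ w ∈ Blk r ∧ x = τ s w - w}).comap (Blk r).subtype) := by
  have hW0 : W 0 = ⨆ r ∈ R₀, (Blk r).map (Coinvariants.mk τ) := by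
    rw [hW]
    refine le_antisymm (iSup₂_le fun r hr => ?_) (iSup₂_le fun r hr => ?_)
    · exact le_biSup (fun r => (Blk r).map (Coinvariants.mk τ)) ((hR₀ r).2 hr)
    · exact le_biSup (fun r => (Blk r).map (Coinvariants.mk τ)) (show r ∈ {r | r ∈ R ∧ ht r = 0} from (hR₀ r).1 hr)
  rw [hW0]
  exact finrank_biSup_map_mk_eq_sum h hact hact1 hperm rep tr htr hrep_act hrep_id hfd R₀ fun r hr => ((hR₀ r).1 hr).1

end Representation
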